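import Mathlib
import HarnessLib

/-!
# Distance functions are DC (Borwein–Zhu 2005, §5.3.1)

Literature anchor transcribing J. M. Borwein and Q. J. Zhu, *Techniques of Variational Analysis*,
CMS Books in Mathematics 20, Springer (2005) [BorweinZhu2005], Chapter 5, §5.3 "Distance
Functions", §5.3.1 "Distance Functions as Differences of Convex Functions", p. 207, with
Exercise 5.3.1 (p. 210) and Exercise 4.5.8 (i) (pp. 150–151), for a subset `S` of a real inner
product space `H` and `d_S = Metric.infDist · S`.

* **Lemma 5.3.1** (`convexOn_of_lipschitz_fderiv`): if `G ⊆ H` is open and convex and `g` is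
  Fréchet differentiable on `G` with a derivative `g'` that is Lipschitz on `G` with constant `L`,
  then `f(x) := L ‖x‖²/2 - g(x)` is convex on `G`. Printed proof: along every segment
  `t ↦ f(a + t v)` the derivative `L ⟪a + t v, v⟩ - ⟨g'(a + t v), v⟩` is monotone
  (`monotone_deriv_along`), so the restriction is convex (Mathlib's `MonotoneOn.convexOn_of_deriv`).
* Exercise 5.3.1 (`norm_fderivNormSub_sub_le`): for `x̄ ∉ S` and
  `G = {x | ‖x - x̄‖ < d_S(x̄)/2}`, the derivative `x ↦ (x - y)/‖x - y‖` of `x ↦ ‖x - y‖`, `y ∈ S`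
  (`hasFDerivAt_norm_sub`), is Lipschitz on `G` with constant `4/d_S(x̄)`; the hint
  `‖x - y‖ > d_S(x̄)/2` on `G` is `lt_norm_sub_of_mem_ball`, and the underlying estimate
  `‖u/‖u‖ - u'/‖u'‖‖ ≤ (2/r) ‖u - u'‖` for `‖u‖, ‖u'‖ ≥ r > 0` is `norm_invSmul_sub_invSmul_le`.
* **Theorem 5.3.2** (Distance Functions Are DC): for `S` closed and `x̄ ∉ S`, with
  `G = B(x̄, d_S(x̄)/2)` and `L = 4/d_S(x̄)`, each `x ↦ L ‖x‖²/2 - ‖x - y‖`, `y ∈ S`, is convex on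
  `G` (`convexOn_half_sq_sub_norm_sub`), hence so is their supremum
  `c(x) = L ‖x‖²/2 - d_S(x)` (`convexOn_half_sq_sub_infDist`), which is continuous; thus
  `d_S = L ‖·‖²/2 - c` is, near every point off `S`, the difference of the `C¹` convex function
  `L ‖·‖²/2` (`convexOn_half_sq`) and a continuous convex function (`infDist_locally_dc`).
* Exercise 4.5.8 (i) (`convexOn_half_sq_sub_half_infDist_sq`): globally, for any nonempty `S`,
  `‖·‖²/2 - d_S²/2 = sup {⟪·, y⟫ - ‖y‖²/2 | y ∈ S}` is convex, so `d_S²` is a difference of convex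
  functions on all of `H`.

Deviations from the printed text, declared: (i) `H` is any real inner product space (completeness
is not used); (ii) in Lemma 5.3.1 the Lipschitz hypothesis is stated pointwise on `G`
(`‖g'(x) - g'(y)‖ ≤ L ‖x - y‖` for `x, y ∈ G`), Fréchet differentiability is assumed at every
point of `G` (so openness of `G` is not needed and is dropped), and the segment is parametrised as
`t ↦ b + t (a - b)` on `[0, 1]` rather than by a unit vector; (iii) in Theorem 5.3.2 the supremum
over `y ∈ S` is handled through `ε`-almost nearest points instead of a pointwise `sup` of functions,
and `S` nonempty is explicit.

## Mathlib / tree status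

Mathlib has `MonotoneOn.convexOn_of_deriv` (one variable), `hasStrictFDerivAt_norm_sq`,
`HasFDerivAt.sqrt`, `convexOn_norm`, `Metric.infDist`; it has no "Lipschitz gradient ⟹
`L ‖·‖²/2 - g` convex" lemma and nothing on the DC structure of `infDist`. In the tree,
`Literature.Analysis.Convex.BaillonHaddad` proves the *global* version of Lemma 5.3.1
(`convexOn_half_sq_sub_of_lipschitzWith`, gradient Lipschitz on all of `H`, convexity on `univ`);
Theorem 5.3.2 needs the local version on an open convex `G` recorded here (the functions
`‖· - y‖` are not differentiable at `y`), proved independently along segments as printed; nothing is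
imported from that file. The derivative formula `hasFDerivAt_norm_sub` also appears (same
statement) as `Literature.Analysis.FluidPDE.DriftHeatInteriorLipschitz.hasFDerivAt_norm_sub`; it is
re-proved here in a few lines so that this file imports only Mathlib. `InfDistConvex` (convexity
of `infDist · R` for convex `R`) is unrelated.
-/

noncomputable section

open Set Filter Metric Topology
open scoped InnerProductSpace

namespace Literature.Analysis.Convex.DistanceFunctionDC

variable {H : Type*} [NormedAddCommGroup H] [InnerProductSpace ℝ H]

/-! ## Lemma 5.3.1 -/

section Lemma531

variable {G : Set H} {g : H → ℝ} {g' : H → H →L[ℝ] ℝ} {L : ℝ}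

/-- The derivative of `t ↦ L ‖b + t (a - b)‖²/2 - g(b + t (a - b))` at `t` is
`L ⟪b + t (a - b), a - b⟫ - g'(b + t (a - b)) (a - b)` (the computation of `h'` in the printed
proof). [cite: BorweinZhu2005, §5.3.1 Lemma 5.3.1 p. 207 (proof)] -/
theorem hasDerivAt_along (hg : ∀ x ∈ G, HasFDerivAt g (g' x) x) {a b : H} {t : ℝ}
    (ht : b + t • (a - b) ∈ G) :
    HasDerivAt (fun s : ℝ => L / 2 * ‖b + s • (a - b)‖ ^ 2 - g (b + s • (a - b)))
      (L * ⟪b + t • (a - b), a - b⟫_ℝ - g' (b + t • (a - b)) (a - b)) t := by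
  have hl : HasDerivAt (fun s : ℝ => b + s • (a - b)) (a - b) t := by
    simpa using ((hasDerivAt_id t).smul_const (a - b)).const_add b
  have h1 : HasDerivAt (fun s : ℝ => ‖b + s • (a - b)‖ ^ 2) (2 * ⟪b + t • (a - b), a - b⟫_ℝ) t :=
    hl.norm_sq
  have h2 : HasDerivAt (fun s : ℝ => g (b + s • (a - b))) (g' (b + t • (a - b)) (a - b)) t :=
    (hg _ ht).comp_hasDerivAt t hl
  have h3 := (h1.const_mul (L / 2)).sub h2
  have h4 : L / 2 * (2 * ⟪b + t • (a - b), a - b⟫_ℝ) - g' (b + t • (a - b)) (a - b) =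
      L * ⟪b + t • (a - b), a - b⟫_ℝ - g' (b + t • (a - b)) (a - b) := by
    ring
  rw [h4] at h3
  exact h3

/-- Along a segment of the open convex set `G` the derivative of
`t ↦ L ‖b + t (a - b)‖²/2 - g(b + t (a - b))` is monotone when `g'` is `L`-Lipschitz on `G`
("`h'(t₂) - h'(t₁) ≥ L (t₂ - t₁) - ‖g'(a + t₂ v) - g'(a + t₁ v)‖ ≥ 0`").
[cite: BorweinZhu2005, §5.3.1 Lemma 5.3.1 p. 207 (proof)] -/
theorem monotone_deriv_along (hL : ∀ x ∈ G, ∀ y ∈ G, ‖g' x - g' y‖ ≤ L * ‖x - y‖) {a b : H}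
    {t₁ t₂ : ℝ} (h₁ : b + t₁ • (a - b) ∈ G) (h₂ : b + t₂ • (a - b) ∈ G) (ht : t₁ ≤ t₂) :
    L * ⟪b + t₁ • (a - b), a - b⟫_ℝ - g' (b + t₁ • (a - b)) (a - b) ≤
      L * ⟪b + t₂ • (a - b), a - b⟫_ℝ - g' (b + t₂ • (a - b)) (a - b) := by
  set x₁ := b + t₁ • (a - b)
  set x₂ := b + t₂ • (a - b)
  have hx : x₂ - x₁ = (t₂ - t₁) • (a - b) := by
    simp only [x₁, x₂]
    rw [sub_smul]
    abel
  have h1 : ⟪x₂, a - b⟫_ℝ - ⟪x₁, a - b⟫_ℝ = (t₂ - t₁) * ‖a - b‖ ^ 2 := by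
    rw [← inner_sub_left, hx, real_inner_smul_left, real_inner_self_eq_norm_sq]
  have h2 : (g' x₂ - g' x₁) (a - b) ≤ L * ((t₂ - t₁) * ‖a - b‖ ^ 2) := by
    calc (g' x₂ - g' x₁) (a - b) ≤ ‖(g' x₂ - g' x₁) (a - b)‖ := Real.le_norm_self _
      _ ≤ ‖g' x₂ - g' x₁‖ * ‖a - b‖ := ContinuousLinearMap.le_opNorm _ _
      _ ≤ L * ‖x₂ - x₁‖ * ‖a - b‖ :=
          mul_le_mul_of_nonneg_right (hL x₂ h₂ x₁ h₁) (norm_nonneg _)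
      _ = L * ((t₂ - t₁) * ‖a - b‖ ^ 2) := by
          rw [hx, norm_smul, Real.norm_eq_abs, abs_of_nonneg (by linarith)]
          ring
  rw [show (g' x₂ - g' x₁) (a - b) = g' x₂ (a - b) - g' x₁ (a - b) from rfl] at h2
  have h3 : L * ⟪x₂, a - b⟫_ℝ - L * ⟪x₁, a - b⟫_ℝ = L * ((t₂ - t₁) * ‖a - b‖ ^ 2) := by
    rw [← mul_sub, h1]
  linarith

/-- **Lemma 5.3.1.** Let `G` be a convex subset of a real inner product space (open, in the printed
statement) and let `g` be Fréchet differentiable at every point of `G` with a derivative `g'` that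
is Lipschitz on `G` with constant `L`. Then `f(x) := L ‖x‖²/2 - g(x)` is convex on `G`.
[cite: BorweinZhu2005, §5.3.1 Lemma 5.3.1 p. 207] -/
theorem convexOn_of_lipschitz_fderiv (hGc : Convex ℝ G) (hg : ∀ x ∈ G, HasFDerivAt g (g' x) x)
    (hL : ∀ x ∈ G, ∀ y ∈ G, ‖g' x - g' y‖ ≤ L * ‖x - y‖) :
    ConvexOn ℝ G (fun x => L / 2 * ‖x‖ ^ 2 - g x) := by
  refine ⟨hGc, fun a ha b hb μ ν hμ hν hμν => ?_⟩
  dsimp only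
  -- restrict to the segment `t ↦ b + t • (a - b)`, `t ∈ [0, 1]`
  set φ : ℝ → ℝ := fun s => L / 2 * ‖b + s • (a - b)‖ ^ 2 - g (b + s • (a - b)) with hφ
  have hseg : ∀ t ∈ Icc (0 : ℝ) 1, b + t • (a - b) ∈ G := by
    intro t ht
    have : b + t • (a - b) = t • a + (1 - t) • b := by
      rw [smul_sub, sub_smul, one_smul]
      abel
    rw [this]
    exact hGc ha hb ht.1 (by linarith [ht.2]) (by ring)
  have hderiv : ∀ t ∈ Icc (0 : ℝ) 1, HasDerivAt φ
      (L * ⟪b + t • (a - b), a - b⟫_ℝ - g' (b + t • (a - b)) (a - b)) t :=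
    fun t ht => hasDerivAt_along hg (hseg t ht)
  have hcont : ContinuousOn φ (Icc 0 1) := fun t ht =>
    (hderiv t ht).continuousAt.continuousWithinAt
  have hdiff : DifferentiableOn ℝ φ (interior (Icc 0 1)) := by
    rw [interior_Icc]
    exact fun t ht => (hderiv t (Ioo_subset_Icc_self ht)).differentiableAt.differentiableWithinAt
  have hmono : MonotoneOn (deriv φ) (interior (Icc 0 1)) := by
    rw [interior_Icc]
    intro t₁ ht₁ t₂ ht₂ ht
    rw [(hderiv t₁ (Ioo_subset_Icc_self ht₁)).deriv, (hderiv t₂ (Ioo_subset_Icc_self ht₂)).deriv]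
    exact monotone_deriv_along hL (hseg t₁ (Ioo_subset_Icc_self ht₁))
      (hseg t₂ (Ioo_subset_Icc_self ht₂)) ht
  have hconv : ConvexOn ℝ (Icc (0 : ℝ) 1) φ :=
    MonotoneOn.convexOn_of_deriv (convex_Icc 0 1) hcont hdiff hmono
  -- evaluate the convexity of `φ` at the points `1`, `0` with weights `μ`, `ν`
  have h := hconv.2 (right_mem_Icc.2 zero_le_one) (left_mem_Icc.2 zero_le_one) hμ hν hμν
  have h1 : φ 1 = L / 2 * ‖a‖ ^ 2 - g a := by
    simp [hφ]
  have h0 : φ 0 = L / 2 * ‖b‖ ^ 2 - g b := by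
    simp [hφ]
  have hμ' : μ • (1 : ℝ) + ν • (0 : ℝ) = μ := by simp
  have h2 : φ μ = L / 2 * ‖μ • a + ν • b‖ ^ 2 - g (μ • a + ν • b) := by
    have hνμ : ν = 1 - μ := by linarith
    have : b + μ • (a - b) = μ • a + ν • b := by
      rw [hνμ, smul_sub, sub_smul, one_smul]
      abel
    simp only [hφ, this]
  rw [hμ', h1, h0] at h
  rw [← h2]
  exact h

end Lemma531

/-! ## Exercise 5.3.1: the derivative of `x ↦ ‖x - y‖` and its Lipschitz constant on `G` -/

/-- The Fréchet derivative of `x ↦ ‖x - y‖` at a point `x ≠ y` of a real inner product space is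
`⟪(x - y)/‖x - y‖, ·⟫` ("`x → ‖x - y‖' = (x - y)/‖x - y‖`").
[cite: BorweinZhu2005, §5.3.1 Thm 5.3.2 p. 207 (proof); §5.3.4 Exercise 5.3.1 p. 210] -/
theorem hasFDerivAt_norm_sub {x y : H} (hxy : x ≠ y) :
    HasFDerivAt (fun z => ‖z - y‖) (‖x - y‖⁻¹ • innerSL ℝ (x - y)) x := by
  have hu : x - y ≠ 0 := sub_ne_zero.2 hxy
  have hpos : 0 < ‖x - y‖ := norm_pos_iff.2 hu
  have h1 : HasFDerivAt (fun z : H => ‖z - y‖ ^ 2) ((2 : ℝ) • innerSL ℝ (x - y)) x := by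
    have := ((hasFDerivAt_id x).sub_const y).norm_sq
    simpa [two_smul] using this
  have h2 := h1.sqrt (by positivity)
  have h3 : (fun z : H => √(‖z - y‖ ^ 2)) = fun z => ‖z - y‖ :=
    funext fun z => Real.sqrt_sq (norm_nonneg _)
  rw [h3, Real.sqrt_sq (norm_nonneg _), smul_smul] at h2
  have h4 : 1 / (2 * ‖x - y‖) * 2 = ‖x - y‖⁻¹ := by
    field_simp
  rw [h4] at h2
  exact h2

/-- `‖u/‖u‖ - u'/‖u'‖‖ ≤ (2/r) ‖u - u'‖` whenever `‖u‖, ‖u'‖ ≥ r > 0`.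
[cite: BorweinZhu2005, §5.3.4 Exercise 5.3.1 p. 210] -/
theorem norm_invSmul_sub_invSmul_le {u u' : H} {r : ℝ} (hr : 0 < r) (hu : r ≤ ‖u‖)
    (hu' : r ≤ ‖u'‖) : ‖‖u‖⁻¹ • u - ‖u'‖⁻¹ • u'‖ ≤ 2 / r * ‖u - u'‖ := by
  have hu0 : 0 < ‖u‖ := hr.trans_le hu
  have hu0' : 0 < ‖u'‖ := hr.trans_le hu'
  have hsplit : ‖u‖⁻¹ • u - ‖u'‖⁻¹ • u' = ‖u‖⁻¹ • (u - u') + (‖u‖⁻¹ - ‖u'‖⁻¹) • u' := by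
    rw [smul_sub, sub_smul]
    abel
  have h1 : ‖‖u‖⁻¹ • (u - u')‖ = ‖u - u'‖ / ‖u‖ := by
    rw [norm_smul, norm_inv, norm_norm, div_eq_inv_mul]
  have h2 : ‖(‖u‖⁻¹ - ‖u'‖⁻¹) • u'‖ = |‖u'‖ - ‖u‖| / ‖u‖ := by
    rw [norm_smul, Real.norm_eq_abs]
    have : ‖u‖⁻¹ - ‖u'‖⁻¹ = (‖u'‖ - ‖u‖) / (‖u‖ * ‖u'‖) := by
      field_simp
    rw [this, abs_div, abs_of_pos (mul_pos hu0 hu0')]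
    field_simp
  have h3 : |‖u'‖ - ‖u‖| ≤ ‖u - u'‖ := by
    rw [abs_sub_comm]
    exact abs_norm_sub_norm_le u u'
  calc ‖‖u‖⁻¹ • u - ‖u'‖⁻¹ • u'‖
      ≤ ‖‖u‖⁻¹ • (u - u')‖ + ‖(‖u‖⁻¹ - ‖u'‖⁻¹) • u'‖ := by
        rw [hsplit]
        exact norm_add_le _ _
    _ = ‖u - u'‖ / ‖u‖ + |‖u'‖ - ‖u‖| / ‖u‖ := by rw [h1, h2]
    _ ≤ ‖u - u'‖ / ‖u‖ + ‖u - u'‖ / ‖u‖ := by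
        gcongr
    _ = 2 * ‖u - u'‖ / ‖u‖ := by ring
    _ ≤ 2 * ‖u - u'‖ / r := div_le_div_of_nonneg_left (by positivity) hr hu
    _ = 2 / r * ‖u - u'‖ := by ring

variable {S : Set H} {xbar : H}

/-- Hint of Exercise 5.3.1: for `x ∈ G = B(x̄, d_S(x̄)/2)` and `y ∈ S`, `‖x - y‖ > d_S(x̄)/2`.
[cite: BorweinZhu2005, §5.3.4 Exercise 5.3.1 p. 210] -/
theorem lt_norm_sub_of_mem_ball {E : Type*} [NormedAddCommGroup E] {S : Set E} {xbar x y : E}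
    (hx : x ∈ ball xbar (infDist xbar S / 2)) (hy : y ∈ S) :
    infDist xbar S / 2 < ‖x - y‖ := by
  rw [mem_ball, dist_eq_norm] at hx
  have h1 : infDist xbar S ≤ ‖xbar - y‖ := by
    rw [← dist_eq_norm]
    exact infDist_le_dist_of_mem hy
  have h2 : ‖xbar - y‖ ≤ ‖xbar - x‖ + ‖x - y‖ := norm_sub_le_norm_sub_add_norm_sub _ _ _
  rw [norm_sub_rev xbar x] at h2
  linarith

/-- **Exercise 5.3.1.** For `x̄ ∉ S`, `G = {x | ‖x - x̄‖ < d_S(x̄)/2}` and `y ∈ S`, the derivative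
`x ↦ (x - y)/‖x - y‖` of `x ↦ ‖x - y‖` is Lipschitz on `G` with Lipschitz constant `4/d_S(x̄)`.
[cite: BorweinZhu2005, §5.3.4 Exercise 5.3.1 p. 210] -/
theorem norm_fderivNormSub_sub_le (hd : 0 < infDist xbar S) {y : H} (hy : y ∈ S) {x x' : H}
    (hx : x ∈ ball xbar (infDist xbar S / 2)) (hx' : x' ∈ ball xbar (infDist xbar S / 2)) :
    ‖‖x - y‖⁻¹ • innerSL ℝ (x - y) - ‖x' - y‖⁻¹ • innerSL ℝ (x' - y)‖ ≤
      4 / infDist xbar S * ‖x - x'‖ := by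
  have h1 : ‖‖x - y‖⁻¹ • innerSL ℝ (x - y) - ‖x' - y‖⁻¹ • innerSL ℝ (x' - y)‖ ≤
      ‖‖x - y‖⁻¹ • (x - y) - ‖x' - y‖⁻¹ • (x' - y)‖ := by
    refine ContinuousLinearMap.opNorm_le_bound _ (norm_nonneg _) fun w => ?_
    have hw : (‖x - y‖⁻¹ • innerSL ℝ (x - y) - ‖x' - y‖⁻¹ • innerSL ℝ (x' - y)) w =
        ⟪‖x - y‖⁻¹ • (x - y) - ‖x' - y‖⁻¹ • (x' - y), w⟫_ℝ := by
      simp [inner_sub_left, real_inner_smul_left, innerSL_apply_apply]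
    rw [hw]
    exact norm_inner_le_norm _ _
  have h2 := norm_invSmul_sub_invSmul_le (half_pos hd) (lt_norm_sub_of_mem_ball hx hy).le
    (lt_norm_sub_of_mem_ball hx' hy).le
  have h3 : (x - y) - (x' - y) = x - x' := by abel
  rw [h3] at h2
  have h4 : 2 / (infDist xbar S / 2) = 4 / infDist xbar S := by
    field_simp
    ring
  rw [h4] at h2
  exact h1.trans h2

/-! ## Theorem 5.3.2 -/

/-- `x ↦ L ‖x‖²/2` is convex (for `L ≥ 0`) — the smooth convex half of the DC decomposition.
[cite: BorweinZhu2005, §5.3.1 Thm 5.3.2 p. 207] -/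
theorem convexOn_half_sq {L : ℝ} (hL : 0 ≤ L) (G : Set H) (hG : Convex ℝ G) :
    ConvexOn ℝ G (fun x => L / 2 * ‖x‖ ^ 2) := by
  have h : ConvexOn ℝ G (fun x : H => ‖x‖ ^ 2) :=
    ((convexOn_norm hG).pow (fun x _ => norm_nonneg x) 2)
  simpa [smul_eq_mul] using h.smul (show 0 ≤ L / 2 by positivity)

/-- Step of Theorem 5.3.2: for `x̄ ∉ S` (closed), `L = 4/d_S(x̄)` and `y ∈ S`, the function
`x ↦ L ‖x‖²/2 - ‖x - y‖` is convex on `G = B(x̄, d_S(x̄)/2)` (Lemma 5.3.1 with Exercise 5.3.1).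
[cite: BorweinZhu2005, §5.3.1 Thm 5.3.2 p. 207 (proof)] -/
theorem convexOn_half_sq_sub_norm_sub (hd : 0 < infDist xbar S) {y : H} (hy : y ∈ S) :
    ConvexOn ℝ (ball xbar (infDist xbar S / 2))
      (fun x => (4 / infDist xbar S) / 2 * ‖x‖ ^ 2 - ‖x - y‖) := by
  refine convexOn_of_lipschitz_fderiv (g' := fun x => ‖x - y‖⁻¹ • innerSL ℝ (x - y))
    (convex_ball _ _) (fun x hx => hasFDerivAt_norm_sub ?_) fun x hx x' hx' =>
    norm_fderivNormSub_sub_le hd hy hx hx'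
  rintro rfl
  have := lt_norm_sub_of_mem_ball hx hy
  rw [sub_self, norm_zero] at this
  linarith

/-- **Theorem 5.3.2**, main step: for `S` closed, `x̄ ∉ S` and `L = 4/d_S(x̄)`, the function
`c(x) := L ‖x‖²/2 - d_S(x) = sup {L ‖x‖²/2 - ‖x - y‖ | y ∈ S}` is convex on
`G = B(x̄, d_S(x̄)/2)`. [cite: BorweinZhu2005, §5.3.1 Thm 5.3.2 p. 207] -/
theorem convexOn_half_sq_sub_infDist (hS : IsClosed S) (hne : S.Nonempty) (hx : xbar ∉ S) :
    ConvexOn ℝ (ball xbar (infDist xbar S / 2))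
      (fun x => (4 / infDist xbar S) / 2 * ‖x‖ ^ 2 - infDist x S) := by
  have hd : 0 < infDist xbar S := (hS.notMem_iff_infDist_pos hne).1 hx
  refine ⟨convex_ball _ _, fun a ha b hb μ ν hμ hν hμν => ?_⟩
  set L := 4 / infDist xbar S
  set z := μ • a + ν • b
  -- approximate `d_S(z)` from above by `‖z - y‖`, `y ∈ S`
  refine le_of_forall_pos_lt_add fun ε hε => ?_
  obtain ⟨y, hy, hyz⟩ := (infDist_lt_iff hne).1 (lt_add_of_pos_right (infDist z S) hε)
  rw [dist_eq_norm] at hyz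
  have hconv := (convexOn_half_sq_sub_norm_sub hd hy).2 ha hb hμ hν hμν
  have ha' : L / 2 * ‖a‖ ^ 2 - ‖a - y‖ ≤ L / 2 * ‖a‖ ^ 2 - infDist a S := by
    have : infDist a S ≤ ‖a - y‖ := by
      rw [← dist_eq_norm]
      exact infDist_le_dist_of_mem hy
    linarith
  have hb' : L / 2 * ‖b‖ ^ 2 - ‖b - y‖ ≤ L / 2 * ‖b‖ ^ 2 - infDist b S := by
    have : infDist b S ≤ ‖b - y‖ := by
      rw [← dist_eq_norm]
      exact infDist_le_dist_of_mem hy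
    linarith
  simp only [smul_eq_mul] at hconv ⊢
  have hμa := mul_le_mul_of_nonneg_left ha' hμ
  have hνb := mul_le_mul_of_nonneg_left hb' hν
  linarith

/-- **Theorem 5.3.2** (Distance Functions Are DC). Let `S` be a closed nonempty subset of a real
inner product space and `x̄ ∉ S`. On `G = B(x̄, d_S(x̄)/2)`, with `L = 4/d_S(x̄)`, the distance
function is the difference `d_S = L ‖·‖²/2 - c` of the `C¹` convex function `L ‖·‖²/2` and a
continuous convex function `c`. [cite: BorweinZhu2005, §5.3.1 Thm 5.3.2 p. 207] -/
theorem infDist_locally_dc (hS : IsClosed S) (hne : S.Nonempty) (hx : xbar ∉ S) :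
    ∃ G ∈ 𝓝 xbar, ∃ L : ℝ, ∃ c : H → ℝ, 0 < L ∧ Convex ℝ G ∧ IsOpen G ∧
      ConvexOn ℝ G (fun x => L / 2 * ‖x‖ ^ 2) ∧ ContDiff ℝ 1 (fun x : H => L / 2 * ‖x‖ ^ 2) ∧
      ConvexOn ℝ G c ∧ Continuous c ∧ ∀ x, infDist x S = L / 2 * ‖x‖ ^ 2 - c x := by
  have hd : 0 < infDist xbar S := (hS.notMem_iff_infDist_pos hne).1 hx
  refine ⟨ball xbar (infDist xbar S / 2), ball_mem_nhds _ (half_pos hd), 4 / infDist xbar S,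
    fun x => (4 / infDist xbar S) / 2 * ‖x‖ ^ 2 - infDist x S, by positivity, convex_ball _ _,
    isOpen_ball, convexOn_half_sq (by positivity) _ (convex_ball _ _),
    contDiff_const.mul (contDiff_norm_sq ℝ), convexOn_half_sq_sub_infDist hS hne hx,
    (continuous_const.mul (continuous_norm.pow 2)).sub (continuous_infDist_pt S),
    fun x => by ring⟩

/-! ## Exercise 4.5.8 (i): `d_S²` is globally a difference of convex functions -/

/-- **Exercise 4.5.8 (i).** For any nonempty `S ⊆ H`, `x ↦ ‖x‖²/2 - d_S(x)²/2` is convex on the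
whole space (it is the conjugate-type supremum `sup {⟪x, y⟫ - ‖y‖²/2 | y ∈ S}` of affine
functions), so `d_S² = ‖·‖² - (‖·‖² - d_S²)` is a difference of convex functions.
[cite: BorweinZhu2005, §4.5.6 Exercise 4.5.8 (i) pp. 150–151] -/
theorem convexOn_half_sq_sub_half_infDist_sq (hne : S.Nonempty) :
    ConvexOn ℝ univ (fun x => ‖x‖ ^ 2 / 2 - infDist x S ^ 2 / 2) := by
  refine ⟨convex_univ, fun a _ b _ μ ν hμ hν hμν => ?_⟩
  set z := μ • a + ν • b
  refine le_of_forall_pos_lt_add fun ε hε => ?_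
  -- an `ε`-almost nearest point `y ∈ S` to `z`: `‖z - y‖² < d_S(z)² + 2ε`
  have hd0 : 0 ≤ infDist z S := infDist_nonneg
  obtain ⟨δ, hδ, hδε⟩ : ∃ δ : ℝ, 0 < δ ∧ (infDist z S + δ) ^ 2 < infDist z S ^ 2 + 2 * ε := by
    have hc : ContinuousAt (fun t : ℝ => (infDist z S + t) ^ 2) 0 := by fun_prop
    have hlt : (infDist z S + 0) ^ 2 < infDist z S ^ 2 + 2 * ε := by rw [add_zero]; linarith
    obtain ⟨δ₀, hδ₀, h⟩ := Metric.eventually_nhds_iff.1 (hc.eventually (gt_mem_nhds hlt))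
    refine ⟨δ₀ / 2, half_pos hδ₀, h ?_⟩
    rw [dist_zero_right, Real.norm_eq_abs, abs_of_pos (half_pos hδ₀)]
    exact half_lt_self hδ₀
  obtain ⟨y, hy, hyz⟩ := (infDist_lt_iff hne).1 (lt_add_of_pos_right (infDist z S) hδ)
  rw [dist_eq_norm] at hyz
  have hyz2 : ‖z - y‖ ^ 2 < infDist z S ^ 2 + 2 * ε :=
    lt_of_le_of_lt (pow_le_pow_left₀ (norm_nonneg _) hyz.le 2) hδε
  -- the affine minorant `x ↦ ⟪x, y⟫ - ‖y‖²/2 = ‖x‖²/2 - ‖x - y‖²/2`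
  have key : ∀ x : H, ⟪x, y⟫_ℝ - ‖y‖ ^ 2 / 2 = ‖x‖ ^ 2 / 2 - ‖x - y‖ ^ 2 / 2 := by
    intro x
    rw [norm_sub_sq_real]
    ring
  have ha : ⟪a, y⟫_ℝ - ‖y‖ ^ 2 / 2 ≤ ‖a‖ ^ 2 / 2 - infDist a S ^ 2 / 2 := by
    rw [key]
    have h1 : infDist a S ≤ ‖a - y‖ := by
      rw [← dist_eq_norm]
      exact infDist_le_dist_of_mem hy
    have h2 := pow_le_pow_left₀ infDist_nonneg h1 2
    linarith
  have hb : ⟪b, y⟫_ℝ - ‖y‖ ^ 2 / 2 ≤ ‖b‖ ^ 2 / 2 - infDist b S ^ 2 / 2 := by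
    rw [key]
    have h1 : infDist b S ≤ ‖b - y‖ := by
      rw [← dist_eq_norm]
      exact infDist_le_dist_of_mem hy
    have h2 := pow_le_pow_left₀ infDist_nonneg h1 2
    linarith
  have hz : ⟪z, y⟫_ℝ - ‖y‖ ^ 2 / 2 =
      μ * (⟪a, y⟫_ℝ - ‖y‖ ^ 2 / 2) + ν * (⟪b, y⟫_ℝ - ‖y‖ ^ 2 / 2) := by
    simp only [z, inner_add_left, real_inner_smul_left]
    have : ν = 1 - μ := by linarith
    subst this
    ring
  have hzf : ‖z‖ ^ 2 / 2 - infDist z S ^ 2 / 2 < ⟪z, y⟫_ℝ - ‖y‖ ^ 2 / 2 + ε := by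
    rw [key]
    linarith
  simp only [smul_eq_mul]
  have hμa := mul_le_mul_of_nonneg_left ha hμ
  have hνb := mul_le_mul_of_nonneg_left hb hν
  linarith

end Literature.Analysis.Convex.DistanceFunctionDC
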